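import Summits.RiemannHypothesis.RiemannHypothesis.Theorems.PfPersistenceBarrierAccumulation
import HarnessLib

/-!
# PF-persistence BARRIER, VII: the parameter-free prime-deletion family accumulates at `ζ` — W2, UNCONDITIONAL

Framing (page 1 of every `pub-rhpf` file): **long-odds MECHANISM SEARCH — nothing here is a claim
about RH.**  Every RH-bearing proposition is a HYPOTHESIS of a theorem, one side of a proved `↔`, or
one branch of a proved DICHOTOMY `¬ WeilPositivity ∨ …`; negativity of a control datum is never
asserted unless PROVED.

`PfPersistenceBarrierAccumulation` proved the zero-margin wall W2 in the continuum model against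
the PLANTED family, whose accumulation at `ζ` uses a free weight parameter `w → 0`.  This file
proves it against the observatory's own PARAMETER-FREE negative family, the prime deletions
`primedel(p) = T_p` (`primedelDatum p`: the Euler factor at `p` removed), where the only parameter is
the prime itself:

* `primedelDatum_quadratic` — `Q_{T_p} = Q_{p,0}`, the F5 dial at `K = 0`.
* `hasSum_vonMangoldt_div_sqrt_multiples` — the deleted mass `∑_{p ∣ n} Λ(n)/√n = log p/(√p − 1)`
  (a geometric series over the powers of `p`).
* `uniformlyClose_zetaDatum_primedelDatum` — `T_p` is UNIFORMLY `2 log p/(√p − 1)`-close to `ζ`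
  on ALL windows (Bombieri's `|(g ⋆ g̃)(t)| ≤ ‖g‖₂²`); the radius tends to `0` as `p → ∞`.
* `exists_rayleigh_lt_prime_scale` — RH-free: for all large `p` the window `b = log p/2 − 1`
  carries a normalised Weil test of Rayleigh quotient `< log p/(4√p)` (double-exponential decay
  of the ground energy, `weilGroundEnergy_exp_exp_decay`, against the single-exponential dial
  threshold of THEOREM F5-A).
* `not_weilPositivity_or_primedel_eventually_not_positivity` — **dichotomy**: either `ζ` fails
  Weil positivity, or EVERY sufficiently large prime deletion FAILS window positivity (THEOREM F5-A,
  `tailDialNegativeOrZetaNotPositive`, at `K = 0`).  The observatory's DATA "primedel negative on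
  every window `a ≥ ½ log p`" is thereby a THEOREM for large `p`, in dichotomy.
* `not_weilPositivity_or_primedel_negativesAccumulateNe` — hence the prime deletions `≠ ζ` that
  fail positivity accumulate UNIFORMLY at `ζ`, and (`no_uniformlyRobust_discriminator_of_accumulate`)
  **no invariant uniformly robust at `ζ` separates `ζ` from the non-positive prime deletions**;
  one that did would refute RH (`not_riemannHypothesis_of_uniformlyRobust_primedel_discriminator`).

Reading for the barrier (`BARRIER.md` §3, leaf B-W2): the accumulation input of W2 needs NO tunable
family and NO observatory data — the declared negative class `{T_p : p prime}` of `CLASS.md` already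
accumulates at `ζ` in the `a`-uniform topology, unconditionally-in-dichotomy.  What it does NOT say:
nothing at a FIXED prime (the Galerkin dial leaf `DialReady`, GAP B-TYPED-2, stays DATA), and nothing
about window-by-window continuity with an `a`-dependent modulus (GAP class G1).

References: E. Bombieri, Rend. Lincei (9) 11 (2000) 183–233, §4 (bib `Bombieri2000Weil`); the F5-A
twin construction `PfPersistenceF5TailTwins` and the decay law `SoloInformedGroundStateDecay2` (tree).
-/

set_option linter.dupNamespace false

noncomputable section

open MeasureTheory Set Filter Complex
open scoped Real Topology ComplexConjugate ArithmeticFunction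

namespace Summit.RiemannHypothesis.RiemannHypothesis.Theorems.PfPersistenceBarrier

open Literature.NumberTheory.LFunctions
open ExplicitDatum
open Summit.RiemannHypothesis.RiemannHypothesis.Theorems.PfPersistenceF5TailTwins

/-! ### The prime-deletion family and its quadratic form -/

/-- The observatory's parameter-free negative family: the prime deletions `T_p`, `p` prime
(`CLASS.md`, family `primedel`). [folklore] -/
def primedelFamily : Set ExplicitDatum := {G | ∃ p : ℕ, p.Prime ∧ G = primedelDatum p}

/-- The prime term of `T_p` is the F5 dialled prime term at `K = 0`. [folklore] -/
theorem primedelDatum_primeTerm (p : ℕ) (k : ℝ → ℂ) :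
    (primedelDatum p).primeTerm k = dialPrimeTerm p 0 k := by
  unfold ExplicitDatum.primeTerm dialPrimeTerm
  refine tsum_congr fun n ↦ ?_
  by_cases h : p ∣ n
  · simp [primedelDatum, h]
  · simp [primedelDatum, zetaDatum, h]

/-- `Q_{T_p} = Q_{p,0}`: the quadratic form of the prime deletion is the F5 dial form at `K = 0`.
[folklore] -/
theorem primedelDatum_quadratic (p : ℕ) (g : ℝ → ℂ) :
    (primedelDatum p).quadratic g = dialQuadratic p 0 g := by
  show (primedelDatum p).smooth _ - (primedelDatum p).primeTerm _ = _
  rw [primedelDatum_primeTerm]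
  show weilPolarTerm _ + weilArchTerm _ - _ = weilPolarTerm _ - _ + weilArchTerm _
  ring

/-- `T_p ≠ ζ`: the deleted coefficient `Λ(p)/√p = log p/√p` is not zero. [folklore] -/
theorem primedelDatum_ne_zetaDatum {p : ℕ} (hp : p.Prime) : primedelDatum p ≠ zetaDatum := by
  intro h
  have h0 : (primedelDatum p).wt p = zetaDatum.wt p := by rw [h]
  have hp1 : (1 : ℝ) < p := by exact_mod_cast hp.one_lt
  simp only [primedelDatum, dvd_refl, if_true, zetaDatum] at h0
  rw [eq_comm, ArithmeticFunction.vonMangoldt_apply_prime hp, div_eq_zero_iff,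
    Complex.ofReal_eq_zero, Complex.ofReal_eq_zero] at h0
  rcases h0 with h0 | h0
  · exact (Real.log_pos hp1).ne' h0
  · exact (Real.sqrt_pos.2 (by linarith)).ne' h0

/-! ### The deleted mass `∑_{p ∣ n} Λ(n)/√n = log p/(√p − 1)` -/

/-- A multiple of the prime `p` that is not a power `p^(k+1)` carries no von Mangoldt mass.
[folklore] -/
theorem vonMangoldt_eq_zero_of_dvd_of_ne_pow {p n : ℕ} (hp : p.Prime) (hpn : p ∣ n)
    (hn : ∀ k : ℕ, n ≠ p ^ (k + 1)) : Λ n = 0 := by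
  by_contra hΛ
  obtain ⟨q, k, hq, hk, rfl⟩ :=
    (isPrimePow_nat_iff _).1 (ArithmeticFunction.vonMangoldt_ne_zero_iff.1 hΛ)
  have hpq : p = q := (Nat.prime_dvd_prime_iff_eq hp hq).1 (hp.dvd_of_dvd_pow hpn)
  subst hpq
  obtain ⟨j, rfl⟩ := Nat.exists_eq_add_one_of_ne_zero hk.ne'
  exact hn j rfl

/-- **The deleted mass.** `∑_{p ∣ n} Λ(n)/√n = log p · ∑_{k ≥ 1} p^{-k/2} = log p/(√p − 1)`.
[folklore] -/
theorem hasSum_vonMangoldt_div_sqrt_multiples {p : ℕ} (hp : p.Prime) :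
    HasSum (fun n : ℕ ↦ if p ∣ n then Λ n / Real.sqrt n else 0)
      (Real.log p / (Real.sqrt p - 1)) := by
  have hp1 : (1 : ℝ) < p := by exact_mod_cast hp.one_lt
  have hp0 : (0 : ℝ) < p := by linarith
  have hsq1 : 1 < Real.sqrt p := by
    rw [← Real.sqrt_one]; exact Real.sqrt_lt_sqrt zero_le_one hp1
  have hsq0 : 0 < Real.sqrt p := by linarith
  have hsqne : Real.sqrt p ≠ 0 := hsq0.ne'
  have hr0 : 0 ≤ (Real.sqrt p)⁻¹ := by positivity
  have hr1 : (Real.sqrt p)⁻¹ < 1 := inv_lt_one_of_one_lt₀ hsq1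
  -- reindex along the powers `k ↦ p^(k+1)`
  set e : ℕ → ℕ := fun k ↦ p ^ (k + 1) with he
  have hinj : Function.Injective e := by
    intro j k hjk
    have h := Nat.pow_right_injective hp.two_le hjk
    simpa using h
  have hzero : ∀ n ∉ Set.range e, (if p ∣ n then Λ n / Real.sqrt n else 0) = 0 := by
    intro n hn
    split_ifs with hpn
    · rw [vonMangoldt_eq_zero_of_dvd_of_ne_pow hp hpn (fun k hk ↦ hn ⟨k, hk.symm⟩), zero_div]
    · rfl
  rw [← hinj.hasSum_iff hzero]
  have hcomp : ((fun n : ℕ ↦ if p ∣ n then Λ n / Real.sqrt n else 0) ∘ e) =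
      fun k ↦ Real.log p * (Real.sqrt p)⁻¹ * ((Real.sqrt p)⁻¹) ^ k := by
    funext k
    simp only [Function.comp_apply, he]
    rw [if_pos (dvd_pow_self p (by omega : k + 1 ≠ 0)),
      ArithmeticFunction.vonMangoldt_apply_pow (by omega : k + 1 ≠ 0),
      ArithmeticFunction.vonMangoldt_apply_prime hp, Nat.cast_pow,
      show ((p : ℝ)) ^ (k + 1) = (Real.sqrt p ^ (k + 1)) ^ 2 by
        rw [← pow_mul, mul_comm, pow_mul, Real.sq_sqrt hp0.le],
      Real.sqrt_sq (pow_nonneg hsq0.le _), div_eq_mul_inv, ← inv_pow, pow_succ]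
    ring
  have hval : Real.log p / (Real.sqrt p - 1) =
      Real.log p * (Real.sqrt p)⁻¹ * (1 - (Real.sqrt p)⁻¹)⁻¹ := by
    rw [div_eq_mul_inv, mul_assoc, ← mul_inv, mul_sub, mul_one, mul_inv_cancel₀ hsqne]
  rw [hcomp, hval]
  exact (hasSum_geometric_of_lt_one hr0 hr1).mul_left (Real.log p * (Real.sqrt p)⁻¹)

/-! ### Uniform closeness of `T_p` to `ζ` -/

/-- **Uniform closeness of the prime deletion.** On every Weil test `g`,
`|Re Q_ζ(g) − Re Q_{T_p}(g)| ≤ (2 log p/(√p − 1)) ‖g‖₂²`: the deleted prime term is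
`∑_{p ∣ n} (Λ(n)/√n)(A(log n) + A(−log n))` with `|A| ≤ ‖g‖₂²` (Bombieri §4 Lemma 2).
[cite: Bombieri2000Weil, §4 L2] -/
theorem uniformlyClose_zetaDatum_primedelDatum {p : ℕ} (hp : p.Prime) :
    UniformlyClose (2 * Real.log p / (Real.sqrt p - 1)) zetaDatum (primedelDatum p) := by
  intro g hg
  set A : ℝ → ℂ := weilConv g (weilReflect g) with hA_def
  set N : ℝ := ∫ x, ‖g x‖ ^ 2 with hN_def
  have hAc : HasCompactSupport A := (hg.weilConv hg.weilReflect).2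
  have hAN : ∀ t, ‖A t‖ ≤ N := fun t ↦ norm_weilConv_weilReflect_le hg t
  set z : ℕ → ℂ := fun n ↦ zetaDatum.wt n * (A (zetaDatum.pos n) + A (-zetaDatum.pos n))
    with hz_def
  set d : ℕ → ℂ := fun n ↦ if p ∣ n then z n else 0 with hd_def
  have hz : Summable z := by
    rw [hz_def]; exact summable_weilPrimeTerm hAc
  have hmaj : ∀ n, ‖d n‖ ≤ (if p ∣ n then Λ n / Real.sqrt n else 0) * (2 * N) := by
    intro n
    by_cases hpn : p ∣ n
    · simp only [hd_def, hz_def, if_pos hpn]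
      rw [norm_mul]
      have h1 : ‖zetaDatum.wt n‖ = Λ n / Real.sqrt n := by
        simp only [zetaDatum]
        rw [norm_div, Complex.norm_real, Complex.norm_real,
          Real.norm_of_nonneg ArithmeticFunction.vonMangoldt_nonneg,
          Real.norm_of_nonneg (Real.sqrt_nonneg _)]
      have h2 : ‖A (zetaDatum.pos n) + A (-zetaDatum.pos n)‖ ≤ 2 * N :=
        (norm_add_le _ _).trans (by linarith [hAN (zetaDatum.pos n), hAN (-zetaDatum.pos n)])
      rw [h1]
      exact mul_le_mul_of_nonneg_left h2
        (div_nonneg ArithmeticFunction.vonMangoldt_nonneg (Real.sqrt_nonneg _))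
    · simp [hd_def, hpn]
  have hsum : HasSum (fun n : ℕ ↦ (if p ∣ n then Λ n / Real.sqrt n else 0) * (2 * N))
      (Real.log p / (Real.sqrt p - 1) * (2 * N)) :=
    (hasSum_vonMangoldt_div_sqrt_multiples hp).mul_right (2 * N)
  have hd : Summable d := Summable.of_norm_bounded hsum.summable hmaj
  -- the prime term of `T_p` is `∑ (z - d)`
  have hsplit : (primedelDatum p).primeTerm A = ∑' n, z n - ∑' n, d n := by
    rw [← hz.tsum_sub hd]
    unfold ExplicitDatum.primeTerm
    refine tsum_congr fun n ↦ ?_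
    by_cases hpn : p ∣ n
    · simp [hd_def, hz_def, primedelDatum, hpn]
    · simp [hd_def, hz_def, primedelDatum, hpn]
  have e1 : zetaDatum.quadratic g = zetaDatum.smooth A - ∑' n, z n := by
    rw [hz_def, hA_def]; rfl
  have e2 : (primedelDatum p).quadratic g = zetaDatum.smooth A - (primedelDatum p).primeTerm A := by
    rw [hA_def]; rfl
  have hdiff : (zetaDatum.quadratic g).re - ((primedelDatum p).quadratic g).re =
      -(∑' n, d n).re := by
    rw [e1, e2, hsplit, ← Complex.sub_re, ← Complex.neg_re]
    congr 1
    ring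
  rw [hdiff, abs_neg]
  calc |(∑' n, d n).re| ≤ ‖∑' n, d n‖ := Complex.abs_re_le_norm _
    _ ≤ Real.log p / (Real.sqrt p - 1) * (2 * N) := tsum_of_norm_bounded hsum hmaj
    _ = 2 * Real.log p / (Real.sqrt p - 1) * N := by ring

/-! ### Large prime deletions fail positivity (dichotomy with `¬ WeilPositivity`) -/

/-- **RH-free input at growing windows.** For all large `p`: `e⁴ ≤ p`, and the window
`b = log p/2 − 1` carries an `L²`-normalised Weil test with `Re Q_ζ < log p/(4√p)` — the ground
energy decays doubly exponentially in the window (`weilGroundEnergy_exp_exp_decay`), the F5-A dial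
threshold `log p/√p` only exponentially. [folklore] -/
theorem exists_rayleigh_lt_prime_scale :
    ∃ p₀ : ℕ, ∀ p : ℕ, p₀ ≤ p → Real.exp 4 ≤ (p : ℝ) ∧
      ∃ g₁ : ℝ → ℂ, IsWeilTest g₁ ∧
        tsupport g₁ ⊆ Icc (-(Real.log p / 2 - 1)) (Real.log p / 2 - 1) ∧
        ∫ x, ‖g₁ x‖ ^ 2 = 1 ∧ (weilQuadratic g₁).re < Real.log p / (4 * Real.sqrt p) := by
  obtain ⟨c, hc, C, hC⟩ := weilGroundEnergy_exp_exp_decay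
  obtain ⟨κ, hκ⟩ : ∃ κ : ℝ, κ = c / Real.exp 2 := ⟨_, rfl⟩
  have hκ0 : 0 < κ := by rw [hκ]; positivity
  have h1 : Tendsto (fun x : ℝ ↦ x ^ 1 * Real.exp (-x)) atTop (𝓝 0) :=
    Real.tendsto_pow_mul_exp_neg_atTop_nhds_zero 1
  have h2 : Tendsto (fun p : ℕ ↦ (4 * |C| / κ) * ((κ * (p : ℝ)) ^ 1 * Real.exp (-(κ * (p : ℝ)))))
      atTop (𝓝 ((4 * |C| / κ) * 0)) :=
    (h1.comp (tendsto_natCast_atTop_atTop.const_mul_atTop hκ0)).const_mul _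
  rw [mul_zero] at h2
  have hev := (h2.eventually (gt_mem_nhds one_pos)).and
    (tendsto_natCast_atTop_atTop.eventually (eventually_ge_atTop (Real.exp 4)))
  obtain ⟨p₀, hp₀⟩ := eventually_atTop.1 hev
  refine ⟨p₀, fun p hp ↦ ?_⟩
  obtain ⟨hsmall, hbig⟩ := hp₀ p hp
  have hp0 : (0 : ℝ) < p := lt_of_lt_of_le (Real.exp_pos 4) hbig
  have hlog4 : 4 ≤ Real.log p := by rw [Real.le_log_iff_exp_le hp0]; exact hbig
  have hsq0 : 0 < Real.sqrt p := Real.sqrt_pos.2 hp0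
  set b : ℝ := Real.log p / 2 - 1 with hb_def
  have hb1 : 1 ≤ b := by rw [hb_def]; linarith
  refine ⟨hbig, ?_⟩
  have he2b : Real.exp (2 * b) = p / Real.exp 2 := by
    rw [hb_def, show 2 * (Real.log p / 2 - 1) = Real.log p - 2 by ring, Real.exp_sub,
      Real.exp_log hp0]
  have hεb : weilGroundEnergy b < Real.log p / (4 * Real.sqrt p) := by
    have hle := hC b hb1
    rw [he2b] at hle
    have hCe : C * Real.exp (-c * (p / Real.exp 2)) ≤ |C| * Real.exp (-(κ * p)) := by
      rw [show -c * (p / Real.exp 2) = -(κ * p) by rw [hκ]; ring]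
      exact mul_le_mul_of_nonneg_right (le_abs_self C) (Real.exp_pos _).le
    have hlt : |C| * Real.exp (-(κ * p)) < 1 / (4 * p) := by
      rw [lt_div_iff₀ (by positivity : (0 : ℝ) < 4 * p)]
      have hκne : κ ≠ 0 := hκ0.ne'
      have e : |C| * Real.exp (-(κ * p)) * (4 * p) =
          4 * |C| / κ * ((κ * (p : ℝ)) ^ 1 * Real.exp (-(κ * (p : ℝ)))) := by
        rw [pow_one, div_mul_eq_mul_div, eq_div_iff hκne]; ring
      rw [e]; exact hsmall
    have hp1 : (1 : ℝ) ≤ p := by linarith [Real.add_one_le_exp (4 : ℝ)]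
    have hsqrt_le : Real.sqrt p ≤ p := by
      rw [Real.sqrt_le_left (by linarith)]
      nlinarith [hp1]
    have hlast : 1 / (4 * (p : ℝ)) ≤ Real.log p / (4 * Real.sqrt p) := by
      rw [div_le_div_iff₀ (by positivity) (by positivity)]
      nlinarith [hsqrt_le, hlog4, mul_nonneg hp0.le (by linarith : (0 : ℝ) ≤ Real.log p - 1),
        Real.sqrt_nonneg (p : ℝ)]
    linarith
  have hlt : sInf (weilWindowSphereValues (fun _ ↦ True) b) < Real.log p / (4 * Real.sqrt p) := by
    rw [← weilGroundEnergy_eq_sInf]; exact hεb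
  obtain ⟨x, ⟨g₁, hg, hs, -, hn, rfl⟩, hx⟩ :=
    exists_lt_of_csInf_lt (weilWindowSphereValues_top_nonempty (by linarith)) hlt
  exact ⟨g₁, hg, hs, hn, hx⟩

/-- **Dichotomy: large prime deletions fail positivity.** Either `ζ` fails Weil positivity, or
there is `p₀` such that EVERY prime deletion `T_p`, `p ≥ p₀` prime, fails window positivity —
THEOREM F5-A (`tailDialNegativeOrZetaNotPositive`, `K = 0`) on the window `b = log p/2 − 1` with the
Rayleigh input of `exists_rayleigh_lt_prime_scale`.  RH appears nowhere. [folklore] -/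
theorem not_weilPositivity_or_primedel_eventually_not_positivity :
    ¬ WeilPositivity ∨
      ∃ p₀ : ℕ, ∀ p : ℕ, p₀ ≤ p → p.Prime → ¬ (primedelDatum p).Positivity := by
  by_cases hW : WeilPositivity
  · obtain ⟨p₀, hp₀⟩ := exists_rayleigh_lt_prime_scale
    refine Or.inr ⟨p₀, fun p hp hprime hpos ↦ ?_⟩
    obtain ⟨hbig, g₁, hg, hs, hn, hq⟩ := hp₀ p hp
    have hp0 : (0 : ℝ) < p := lt_of_lt_of_le (Real.exp_pos 4) hbig
    have hlog4 : 4 ≤ Real.log p := by rw [Real.le_log_iff_exp_le hp0]; exact hbig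
    have hsq : 0 < Real.sqrt p := Real.sqrt_pos.2 hp0
    have hb : 0 < Real.log p / 2 - 1 := by linarith
    have hb2 : 2 * (Real.log p / 2 - 1) < Real.log p := by linarith
    have hδ : 2 * (Real.log p / (4 * Real.sqrt p)) < |1 - (0 : ℝ)| * Real.log p / Real.sqrt p := by
      rw [sub_zero, abs_one, one_mul,
        show 2 * (Real.log p / (4 * Real.sqrt p)) = Real.log p / Real.sqrt p / 2 by ring]
      have hlp : 0 < Real.log p / Real.sqrt p := div_pos (by linarith) hsq
      linarith
    have h := tailDialNegativeOrZetaNotPositive p hprime 0 (Real.log p / 2 - 1)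
      (Real.log p / (4 * Real.sqrt p)) le_rfl hb hb2 g₁ hg hs (by rw [hn, mul_one]; exact hq.le)
      (by rw [hn]; exact one_pos) hδ
    rcases h with hnot | hneg
    · exact hnot (fun g hg' _ ↦ hW g hg')
    · have h0 := hpos (tailTwinTest p 0 g₁) (isWeilTest_twin hg _ _)
      rw [primedelDatum_quadratic] at h0
      exact absurd hneg (not_lt.2 h0)
  · exact Or.inl hW

/-- Under RH (Weil's criterion) every large prime deletion fails window positivity — the
observatory's `primedel` DATA as a conditional theorem. [folklore] -/
theorem primedel_eventually_not_positivity_of_riemannHypothesis (hRH : RiemannHypothesis) :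
    ∃ p₀ : ℕ, ∀ p : ℕ, p₀ ≤ p → p.Prime → ¬ (primedelDatum p).Positivity :=
  not_weilPositivity_or_primedel_eventually_not_positivity.resolve_left
    (not_not.2 (weil_criterion_holds.1 hRH))

/-! ### Accumulation of the prime deletions at `ζ` and the wall W2 -/

/-- **Dichotomy: the prime deletions accumulate at `ζ`.** Either `ζ` fails Weil positivity, or for
every `ε > 0` some prime deletion `T_p ≠ ζ`, uniformly `ε`-close to `ζ`, fails window positivity
(`2 log p/(√p − 1) → 0`, primes are unbounded). [folklore] -/
theorem not_weilPositivity_or_primedel_negativesAccumulateNe :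
    ¬ WeilPositivity ∨ NegativesAccumulateNe primedelFamily zetaDatum := by
  rcases not_weilPositivity_or_primedel_eventually_not_positivity with hW | ⟨p₀, hp₀⟩
  · exact Or.inl hW
  · refine Or.inr fun ε hε ↦ ?_
    have hT : Tendsto (fun n : ℕ ↦ Real.log (Real.sqrt n) ^ 1 / (1 * Real.sqrt n + 0))
        atTop (𝓝 0) :=
      (Real.tendsto_pow_log_div_mul_add_atTop 1 0 1 one_ne_zero).comp
        (Real.tendsto_sqrt_atTop.comp tendsto_natCast_atTop_atTop)
    obtain ⟨P, hP⟩ := eventually_atTop.1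
      ((hT.eventually (gt_mem_nhds (by positivity : (0 : ℝ) < ε / 8))).and
        (eventually_ge_atTop (max p₀ 4)))
    obtain ⟨p, hpP, hprime⟩ := Nat.exists_infinite_primes P
    obtain ⟨hlt, hge⟩ := hP p hpP
    have hp4 : (4 : ℝ) ≤ p := by exact_mod_cast (le_max_right p₀ 4).trans hge
    have hp0 : (0 : ℝ) < p := by linarith
    have h4 : Real.sqrt 4 = 2 := by
      rw [show (4 : ℝ) = 2 ^ 2 by norm_num]; exact Real.sqrt_sq (by norm_num)
    have hsq2 : 2 ≤ Real.sqrt p := h4 ▸ Real.sqrt_le_sqrt hp4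
    have hsq0 : 0 < Real.sqrt p := by linarith
    refine ⟨primedelDatum p, ⟨p, hprime, rfl⟩, primedelDatum_ne_zetaDatum hprime,
      hp₀ p ((le_max_left _ _).trans hge) hprime, ?_⟩
    refine (uniformlyClose_zetaDatum_primedelDatum hprime).mono ?_
    simp only [pow_one, one_mul, add_zero] at hlt
    rw [Real.log_sqrt hp0.le] at hlt
    have h1 : Real.log p / 2 < ε / 8 * Real.sqrt p := (div_lt_iff₀ hsq0).1 hlt
    have hden : 0 < Real.sqrt p - 1 := by linarith
    rw [div_le_iff₀ hden]
    nlinarith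

/-- Under RH the non-positive prime deletions `≠ ζ` accumulate uniformly at `ζ`. [folklore] -/
theorem primedel_negativesAccumulateNe_of_riemannHypothesis (hRH : RiemannHypothesis) :
    NegativesAccumulateNe primedelFamily zetaDatum :=
  not_weilPositivity_or_primedel_negativesAccumulateNe.resolve_left
    (not_not.2 (weil_criterion_holds.1 hRH))

/-- **W2 against the prime-deletion family (UNCONDITIONAL).** No predicate uniformly robust at
`ζ` discriminates `ζ` from a declared negative class `Neg` containing the non-positive prime
deletions and containing `ζ` itself should `ζ` fail positivity (the semantic convention of
`CLASS.md`: negatives are the non-positive data).  Branch `WeilPositivity`: the non-positive `T_p`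
accumulate inside the robustness ball; branch `¬ WeilPositivity`: `ζ ∈ Neg` is on both sides.
[folklore] -/
theorem no_uniformlyRobust_primedel_discriminator {P : ExplicitDatum → Prop}
    (hP : UniformlyRobustAt P zetaDatum) {Neg : Set ExplicitDatum}
    (hNeg : ∀ G ∈ primedelFamily, ¬ G.Positivity → G ∈ Neg)
    (hζ : ¬ zetaDatum.Positivity → zetaDatum ∈ Neg) :
    ¬ Discriminates P zetaDatum Neg := by
  rcases not_weilPositivity_or_primedel_negativesAccumulateNe with hW | hacc
  · intro hdisc
    exact hdisc.not_of_mem (hζ (fun h ↦ hW (zetaDatum_positivity_iff.1 h))) hdisc.self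
  · exact no_uniformlyRobust_discriminator_of_accumulate hP hacc hNeg

/-- **A uniformly robust invariant separating `ζ` from the non-positive prime deletions REFUTES
RH.** (Contrapositive reading of W2 for the declared family `primedel`.) [folklore] -/
theorem not_riemannHypothesis_of_uniformlyRobust_primedel_discriminator
    {P : ExplicitDatum → Prop} (hP : UniformlyRobustAt P zetaDatum) {Neg : Set ExplicitDatum}
    (hNeg : ∀ G ∈ primedelFamily, ¬ G.Positivity → G ∈ Neg)
    (hdisc : Discriminates P zetaDatum Neg) : ¬ RiemannHypothesis := fun hRH ↦
  no_uniformlyRobust_discriminator_of_accumulate hP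
    (primedel_negativesAccumulateNe_of_riemannHypothesis hRH) hNeg hdisc

end Summit.RiemannHypothesis.RiemannHypothesis.Theorems.PfPersistenceBarrier

end
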